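import Mathlib
import Summits.MatrixMultiplication.MatrixMultiplication.Theses.LevelGradedCohnUmans

/-!
# `SnLevelDesigns` (stmt-MatrixMultiplication-7613), line `garnir-annihilator`:
# J4 `stub_floatingFrameCount` — in a junta design the frame floats in BOTH coordinates

Crux `Summit.MatrixMultiplication.MatrixMultiplication.Theses.LevelGradedCohnUmans.SnLevelDesigns`;
skeleton `Cruxes/SnLevelDesigns/Lines/garnir_annihilator.lean` (registered stub J4,
"floating-frame counts"); this file proves the registered stub `stub_floatingFrameCount` verbatim
(name + signature, Mathlib-only vocabulary) and lands `--supports stmt-MatrixMultiplication-7613`.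

In the junta sub-certificate of the line a target `t = x₀⁻¹ z₀` (`x₀ ∈ X`, `z₀ ∈ Z`) is told
apart from its garbage `x⁻¹ y y'⁻¹ z` by the restriction `t ∘ ι` to a frame `ι : Fin k → Fin n`
chosen PER TARGET. The one-frame case (J2, `stub_uniformJuntaWall`) caps `|X|·|Z|` at `n ^ k`;
this stub is its floating generalisation, counting the frames actually used:

* (a) the middle floats: for a fixed row `x₀` with frames `U z₀` attached to the targets
  `(x₀, z₀)`, separation against the garbage `x₀⁻¹ y y'⁻¹ z` (`¬ (y = y' ∧ z = z₀)`) forces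
  `|Y|·|Z| ≤ #(Z.image U) · n ^ k`. Indeed `(y, z) ↦ (U z, (y⁻¹ z) ∘ U z)` is injective on
  `Y ×ˢ Z`: equal images give a common frame `ι = U z = U z'` and `(y⁻¹ z) ∘ ι = (y'⁻¹ z') ∘ ι`,
  and composing with `x₀⁻¹ y` on the left turns the latter into
  `(x₀⁻¹ y y'⁻¹ z') ∘ ι = (x₀⁻¹ z) ∘ ι`, which the hypothesis at the target `z₀ := z` forbids
  unless `y = y'` and `z' = z`; the image lies in `(Z.image U) ×ˢ univ`, of cardinality
  `#(Z.image U) · n ^ k`.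
* (b) the label form of J2: with a frame `U x₀ z₀` per target, separation against the other
  targets `x⁻¹ z` forces `|X|·|Z| ≤ #((X ×ˢ Z).image U) · n ^ k`, by the same argument with the
  map `(x, z) ↦ (U x z, (x⁻¹ z) ∘ U x z)`.

Proof (Mathlib only): `Finset.card_product`, `Finset.card_le_card_of_injOn` into
`S ×ˢ (Finset.univ : Finset (Fin k → Fin n))`, `Finset.card_univ`, `Fintype.card_fun`,
`Fintype.card_fin`, `Equiv.Perm.coe_mul`, `Equiv.apply_symm_apply`.
-/

-- the problem path repeats `MatrixMultiplication` (summit = problem), as in every file of this line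
set_option linter.dupNamespace false

namespace Summit.MatrixMultiplication.MatrixMultiplication.Theorems.SnLevelDesigns

/-- Cardinal bookkeeping shared by both parts: for a finset `S` of frames,
`#(S ×ˢ univ) = #S · n ^ k`, where `univ : Finset (Fin k → Fin n)` has `n ^ k` elements. -/
theorem ffc_card_product_univ {n k : ℕ} (S : Finset (Fin k → Fin n)) :
    (S ×ˢ (Finset.univ : Finset (Fin k → Fin n))).card = S.card * n ^ k := by
  rw [Finset.card_product, Finset.card_univ, Fintype.card_fun, Fintype.card_fin, Fintype.card_fin]

/-- Part (a), injectivity (the middle floats). Fix a row `x₀` and frames `U z₀` for the targets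
`x₀⁻¹ z₀`; if every target is separated on its frame from the garbage `x₀⁻¹ y y'⁻¹ z`
(`y, y' ∈ Y`, `z ∈ Z`, `¬ (y = y' ∧ z = z₀)`), then `(y, z) ↦ (U z, (y⁻¹ z) ∘ U z)` is injective
on `Y ×ˢ Z`: from `U z = U z' =: ι` and `(y⁻¹ z) ∘ ι = (y'⁻¹ z') ∘ ι` one gets, composing with
`x₀⁻¹ y`, `(x₀⁻¹ y y'⁻¹ z') ∘ ι = (x₀⁻¹ z) ∘ ι`, contradicting the hypothesis at the target
`z₀ := z` with the quadruple `(y, y', z')` unless `y = y'` and `z' = z`. -/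
theorem ffc_injOn_middle {n k : ℕ} (Y Z : Finset (Equiv.Perm (Fin n))) (x₀ : Equiv.Perm (Fin n))
    (U : Equiv.Perm (Fin n) → (Fin k → Fin n))
    (h : ∀ z₀ ∈ Z, ∀ y ∈ Y, ∀ y' ∈ Y, ∀ z ∈ Z, ¬ (y = y' ∧ z = z₀) →
      (⇑(x₀⁻¹ * y * y'⁻¹ * z)) ∘ (U z₀) ≠ (⇑(x₀⁻¹ * z₀)) ∘ (U z₀)) :
    Set.InjOn (fun p : Equiv.Perm (Fin n) × Equiv.Perm (Fin n) =>
        (U p.2, (⇑(p.1⁻¹ * p.2)) ∘ U p.2)) ↑(Y ×ˢ Z) := by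
  rintro ⟨y, z⟩ hp ⟨y', z'⟩ hq hpq
  obtain ⟨hy, hz⟩ := Finset.mem_product.1 (Finset.mem_coe.1 hp)
  obtain ⟨hy', hz'⟩ := Finset.mem_product.1 (Finset.mem_coe.1 hq)
  simp only [Prod.mk.injEq] at hpq ⊢
  obtain ⟨hU, hres⟩ := hpq
  by_contra hne
  have hne' : ¬ (y = y' ∧ z' = z) := fun hh => hne ⟨hh.1, hh.2.symm⟩
  rw [← hU] at hres
  refine h z hz y hy y' hy' z' hz' hne' ?_
  funext i
  have hi := congrFun hres i
  simp only [Function.comp_apply, Equiv.Perm.coe_mul] at hi ⊢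
  rw [← hi]
  exact congrArg (⇑x₀⁻¹) (Equiv.apply_symm_apply y _)

/-- Part (b), injectivity (the label form of the uniform junta wall). With a frame `U x₀ z₀`
per target `x₀⁻¹ z₀`, if every target is separated on its frame from the other targets `x⁻¹ z`
(`(x, z) ≠ (x₀, z₀)`), then `(x, z) ↦ (U x z, (x⁻¹ z) ∘ U x z)` is injective on `X ×ˢ Z`:
equal images give a common frame `ι = U x z = U x' z'` and `(x⁻¹ z) ∘ ι = (x'⁻¹ z') ∘ ι`,
which the hypothesis at the target `(x₀, z₀) := (x, z)` with `(x', z')` forbids unless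
`(x', z') = (x, z)`. -/
theorem ffc_injOn_pair {n k : ℕ} (X Z : Finset (Equiv.Perm (Fin n)))
    (U : Equiv.Perm (Fin n) → Equiv.Perm (Fin n) → (Fin k → Fin n))
    (h : ∀ x₀ ∈ X, ∀ z₀ ∈ Z, ∀ x ∈ X, ∀ z ∈ Z, ¬ (x = x₀ ∧ z = z₀) →
      (⇑(x⁻¹ * z)) ∘ (U x₀ z₀) ≠ (⇑(x₀⁻¹ * z₀)) ∘ (U x₀ z₀)) :
    Set.InjOn (fun p : Equiv.Perm (Fin n) × Equiv.Perm (Fin n) =>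
        (U p.1 p.2, (⇑(p.1⁻¹ * p.2)) ∘ U p.1 p.2)) ↑(X ×ˢ Z) := by
  rintro ⟨x, z⟩ hp ⟨x', z'⟩ hq hpq
  obtain ⟨hx, hz⟩ := Finset.mem_product.1 (Finset.mem_coe.1 hp)
  obtain ⟨hx', hz'⟩ := Finset.mem_product.1 (Finset.mem_coe.1 hq)
  simp only [Prod.mk.injEq] at hpq ⊢
  obtain ⟨hU, hres⟩ := hpq
  by_contra hne
  have hne' : ¬ (x' = x ∧ z' = z) := fun hh => hne ⟨hh.1.symm, hh.2.symm⟩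
  rw [← hU] at hres
  exact h x hx z hz x' hx' z' hz' hne' hres.symm

/-- **`stub_floatingFrameCount`** (registered stub J4 of crux stmt-MatrixMultiplication-7613, line
`garnir-annihilator`; floating-frame counts). In a junta design the frame must float in BOTH
coordinates. (a) For a fixed row `x₀` with frames `U z₀` attached to the targets `x₀⁻¹ z₀`
(`z₀ ∈ Z`), separation of each target from its garbage `x₀⁻¹ y y'⁻¹ z` (`y, y' ∈ Y`, `z ∈ Z`,
`¬ (y = y' ∧ z = z₀)`) on the frame `U z₀` forces `|Y| · |Z| ≤ #(Z.image U) · n ^ k` — so a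
near-wall design uses many distinct frames in every row. (b) With a frame `U x₀ z₀` per target,
separation of each target from the other targets `x⁻¹ z` forces
`|X| · |Z| ≤ #((X ×ˢ Z).image U) · n ^ k` (the label form of J2 `stub_uniformJuntaWall`).
Proof: the maps `(y, z) ↦ (U z, (y⁻¹ z) ∘ U z)` (`ffc_injOn_middle`) and
`(x, z) ↦ (U x z, (x⁻¹ z) ∘ U x z)` (`ffc_injOn_pair`) are injective on the product finsets with
values in `frames ×ˢ univ`, a finset of cardinality `#frames · n ^ k` (`ffc_card_product_univ`);
conclude with `Finset.card_product` and `Finset.card_le_card_of_injOn`. -/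
theorem stub_floatingFrameCount :
    (∀ (n k : ℕ) (Y Z : Finset (Equiv.Perm (Fin n))) (x₀ : Equiv.Perm (Fin n))
        (U : Equiv.Perm (Fin n) → (Fin k → Fin n)),
      (∀ z₀ ∈ Z, ∀ y ∈ Y, ∀ y' ∈ Y, ∀ z ∈ Z, ¬ (y = y' ∧ z = z₀) →
          (⇑(x₀⁻¹ * y * y'⁻¹ * z)) ∘ (U z₀) ≠ (⇑(x₀⁻¹ * z₀)) ∘ (U z₀)) →
      Y.card * Z.card ≤ (Z.image U).card * n ^ k) ∧
    (∀ (n k : ℕ) (X Z : Finset (Equiv.Perm (Fin n)))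
        (U : Equiv.Perm (Fin n) → Equiv.Perm (Fin n) → (Fin k → Fin n)),
      (∀ x₀ ∈ X, ∀ z₀ ∈ Z, ∀ x ∈ X, ∀ z ∈ Z, ¬ (x = x₀ ∧ z = z₀) →
          (⇑(x⁻¹ * z)) ∘ (U x₀ z₀) ≠ (⇑(x₀⁻¹ * z₀)) ∘ (U x₀ z₀)) →
      X.card * Z.card ≤ ((X ×ˢ Z).image (fun p => U p.1 p.2)).card * n ^ k) := by
  refine ⟨?_, ?_⟩
  · intro n k Y Z x₀ U h
    calc Y.card * Z.card = (Y ×ˢ Z).card := (Finset.card_product Y Z).symm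
      _ ≤ ((Z.image U) ×ˢ (Finset.univ : Finset (Fin k → Fin n))).card :=
          Finset.card_le_card_of_injOn
            (fun p : Equiv.Perm (Fin n) × Equiv.Perm (Fin n) =>
              (U p.2, (⇑(p.1⁻¹ * p.2)) ∘ U p.2))
            (fun p hp => Finset.mem_coe.2 (Finset.mem_product.2
              ⟨Finset.mem_image_of_mem U (Finset.mem_product.1 (Finset.mem_coe.1 hp)).2,
                Finset.mem_univ _⟩))
            (ffc_injOn_middle Y Z x₀ U h)
      _ = (Z.image U).card * n ^ k := ffc_card_product_univ _
  · intro n k X Z U h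
    calc X.card * Z.card = (X ×ˢ Z).card := (Finset.card_product X Z).symm
      _ ≤ (((X ×ˢ Z).image (fun p => U p.1 p.2)) ×ˢ
            (Finset.univ : Finset (Fin k → Fin n))).card :=
          Finset.card_le_card_of_injOn
            (fun p : Equiv.Perm (Fin n) × Equiv.Perm (Fin n) =>
              (U p.1 p.2, (⇑(p.1⁻¹ * p.2)) ∘ U p.1 p.2))
            (fun p hp => Finset.mem_coe.2 (Finset.mem_product.2
              ⟨Finset.mem_image_of_mem (fun p => U p.1 p.2) (Finset.mem_coe.1 hp),
                Finset.mem_univ _⟩))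
            (ffc_injOn_pair X Z U h)
      _ = ((X ×ˢ Z).image (fun p => U p.1 p.2)).card * n ^ k := ffc_card_product_univ _

end Summit.MatrixMultiplication.MatrixMultiplication.Theorems.SnLevelDesigns
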